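import Summits.QuantumAdvantage.QuantumAdvantage.Theorems.NearExactIsExact.Negative.SkewProductResidual

/-!
# `NearExactIsExact` (stmt-QuantumAdvantage-14043) — THEOREM CYL6: the cylinder case of the
frame-preserving ("triangular") analysis is dead (disprover gen 36, DISPROOF §45.14)

THEOREM A (`SkewProductResidual.skewProduct_residual_ne_flat`, gen 17) kills the skew products
`π(u,t) = (γ u, t ⊕ ρ(γ u))` whose fibre maps are TRANSLATIONS.  Here we observe that when the base
map is the identity (`γ = id`, the frame-preserving maps of `TriangularBqq*`), the same Euler /
parity count survives arbitrary fibre-AFFINE block maps `π_u(w) = M(u)w ⊕ a(u)` with `u ↦ M(u)⁻¹`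
affine: the only change is that `ĉ_k(u) = c₁(u, y_k(u)) ⊕ c₁(u, 0)`, with `y_k(u) = M(u)⁻¹ e_k`
AFFINE in `u`, has degree `≤ 3` instead of `≤ 2`, and `2 + 3 = 5 < 6` is still enough.

* `core3` — `SkewProductCore.core` with the hypothesis on `ĉ_k ∘ γ` relaxed from quadratic to cubic.
* `frameAffine_residual_ne_flat` — **THEOREM CYL6**: over a 6-bit frame `u ∈ 𝔽₂⁶` with ANY number `r`
  of block bits, block maps `P u : 𝔽₂^r → 𝔽₂^r` with `P u 0 = a(u)` quadratic in `u` and affine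
  sections `y_k(u)` with `P u (y_k u) = a(u) ⊕ e_k`, and cubic `c₁, c₂`: the residual
  `c₁(u,w) ⊕ c₂(u, P u w)` is never the cylinder indicator `[u = 0]`.

Consequence (paper, DISPROOF §45.14, with the s = 11 normal form D2 and `IsolatingFlat.exists_affine_isolating`
at j = 6): cylinder residuals `1_N(t) ⊗ 1` of frame-preserving biquadratic maps obey BQQ for every block size, so
`TriangularBqqFive.bqq_triangular_five_or_cylinder` becomes BQQ in full for 5-bit blocks.  Refuter-side structure
(no positive Theses statement is concluded); not summit progress.
-/

namespace Summit.QuantumAdvantage.QuantumAdvantage.Theorems.NearExactIsExact.Negative.CylinderSix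

open Finset
open Literature.Computability.QuantumComplexity
open Literature.Computability.QuantumComplexity.BuzetChailloux (bxor)
open Summit.QuantumAdvantage.QuantumAdvantage.Theorems.CubicForrelation.NearExactIsExact
open Summit.QuantumAdvantage.QuantumAdvantage.Theorems.SignedExactCubicForrelationNotPrBPP.PolarGeometry
open Summit.QuantumAdvantage.QuantumAdvantage.Theorems.NearExactIsExact.Negative.SkewProductCore
open Summit.QuantumAdvantage.QuantumAdvantage.Theorems.NearExactIsExact.Negative.SkewProductResidual

variable {r : ℕ}

/-- `SkewProductCore.core` with `ĉ_k ∘ γ` only CUBIC: `γ` a bijection of `𝔽₂⁶`; `ρ_k`, `ρ_k ∘ γ`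
quadratic; `deg C_S ≤ 3 − |S|`; every `ĉ_k ∘ γ` of degree `≤ 3`.  Then `Σ_v ĉ(v) = 0`
(`deg (ρ_k ∘ γ)·(ĉ_k ∘ γ) ≤ 5 < 6`). [folklore] -/
theorem core3 {γ : (Fin 6 → Bool) → (Fin 6 → Bool)} (hγ : Function.Bijective γ)
    {ρ : Fin r → (Fin 6 → Bool) → Bool} (hρ : ∀ k, IsDegLeFun 2 (ρ k))
    (hργ : ∀ k, IsDegLeFun 2 (fun u => ρ k (γ u)))
    {C : Finset (Fin r) → (Fin 6 → Bool) → Bool} (hC : ∀ S, IsDegLeFun (3 - S.card) (C S))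
    (hk : ∀ k, IsDegLeFun 3 (fun u => decide (tcoef ρ C k (γ u) = 1))) :
    ∑ v, texp C (fun j => ρ j v) v = 0 := by
  have hG : IsDegLeFun 5 (fun v => decide ((∑ S ∈ (P3 r).filter (fun S => Even S.card),
      (∏ j ∈ S, ind (ρ j v)) * ind (C S v)) = 1)) := by
    refine isDegLeFun_sum (fun S v => (∏ j ∈ S, ind (ρ j v)) * ind (C S v)) _ (fun S hS => ?_)
    rw [mem_filter, mem_P3] at hS
    obtain ⟨h3, m, hm⟩ := hS
    have e : (fun v => decide ((∏ j ∈ S, ind (ρ j v)) * ind (C S v) = 1)) =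
        fun v => (decide ((∏ j ∈ S, ind (ρ j v)) = 1) && C S v) := by
      funext v; rw [zmod2_decide_mul, decide_ind_eq_one]
    rw [e]
    exact (te_isDegLeFun_band (isDegLeFun_prod (fun j => ρ j) S (fun j _ => hρ j)) (hC S)).mono (by omega)
  have hsumG : ∑ v, (∑ S ∈ (P3 r).filter (fun S => Even S.card),
      (∏ j ∈ S, ind (ρ j v)) * ind (C S v)) = 0 := by
    have h0 := sum_ind_eq_zero_of_deg_five hG
    simpa only [ind_decide_eq_one] using h0
  have hsumK : ∀ k, ∑ v, ind (ρ k v) * tcoef ρ C k v = 0 := by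
    intro k
    have hdeg : IsDegLeFun 5 (fun u => ρ k (γ u) && decide (tcoef ρ C k (γ u) = 1)) :=
      (te_isDegLeFun_band (hργ k) (hk k)).mono (by norm_num)
    have h0 := sum_ind_comp_eq_zero hγ (F := fun v => ρ k v && decide (tcoef ρ C k v = 1)) hdeg
    simpa only [ind_and, ind_decide_eq_one] using h0
  have htot : ∑ v, (texp C (fun j => ρ j v) v + ∑ k, ind (ρ k v) * tcoef ρ C k v) = 0 := by
    rw [sum_congr rfl (fun v _ => euler ρ C v)]
    exact hsumG
  rw [sum_add_distrib, sum_comm, sum_congr rfl (fun k _ => hsumK k), sum_const_zero, add_zero] at htot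
  exact htot

/-- The coordinates of `u ↦ (u, y(u))` are affine when those of `y` are. [folklore] -/
theorem append_coord_deg (y : (Fin 6 → Bool) → (Fin r → Bool)) (hy : ∀ j, IsDegLeFun 1 (fun u => y u j)) :
    ∀ j : Fin (6 + r), IsDegLeFun 1 (fun u : Fin 6 → Bool => Fin.append u (y u) j) := by
  intro j
  induction j using Fin.addCases with
  | left i =>
    have e : (fun u : Fin 6 → Bool => Fin.append u (y u) (Fin.castAdd r i)) = fun u => u i :=
      funext fun u => Fin.append_left u _ i
    rw [e]
    exact isDegLeFun_apply i le_rfl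
  | right k =>
    have e : (fun u : Fin 6 → Bool => Fin.append u (y u) (Fin.natAdd 6 k)) = fun u => y u k :=
      funext fun u => Fin.append_right u _ k
    rw [e]
    exact hy k

/-- **THEOREM CYL6 (gen 36).**  Frame `u ∈ 𝔽₂⁶`, block `w ∈ 𝔽₂^r`, block maps `P u` with
`P u 0 = a(u)`, `a` quadratic, and AFFINE sections `y_k` with `P u (y_k u) = a(u) ⊕ e_k` (for
`P u w = M(u)w ⊕ a(u)` take `y_k(u) = M(u)⁻¹e_k`, affine as soon as `u ↦ M(u)⁻¹` is); `c₁, c₂`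
cubic on `6 + r` bits.  Then `c₁(u,w) ⊕ c₂(u, P u w)` is NOT the cylinder indicator `[u = 0]`.
Proof = THEOREM A's: `ĉ(u) := c₂(u, a u) = c₁(u,0) ⊕ [u = 0]` has odd weight, while the Euler
identity writes `ĉ` as a sum of terms of degree `≤ 5` on `𝔽₂⁶` (`ĉ_k = c₁(u, y_k u) ⊕ c₁(u, 0)`
is cubic). [folklore] -/
theorem frameAffine_residual_ne_flat (P : (Fin 6 → Bool) → (Fin r → Bool) → (Fin r → Bool))
    (a : Fin r → (Fin 6 → Bool) → Bool) (ha : ∀ k, IsDegLeFun 2 (a k))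
    (hP0 : ∀ u, P u (fun _ => false) = fun k => a k u)
    (yk : Fin r → (Fin 6 → Bool) → (Fin r → Bool)) (hyk : ∀ k j, IsDegLeFun 1 (fun u => yk k u j))
    (hPyk : ∀ k u, P u (yk k u) = fun j => (decide (j = k) ^^ a j u))
    (c₁ c₂ : (Fin (6 + r) → Bool) → Bool) (h₁ : IsDegLeFun 3 c₁) (h₂ : IsDegLeFun 3 c₂) :
    ¬ ∀ (u : Fin 6 → Bool) (w : Fin r → Bool),
      (c₁ (Fin.append u w) ^^ c₂ (Fin.append u (P u w))) = decide (∀ i, u i = false) := by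
  intro h
  have hx : ∀ (u : Fin 6 → Bool) (w : Fin r → Bool),
      c₂ (Fin.append u (P u w)) = (c₁ (Fin.append u w) ^^ decide (∀ i, u i = false)) :=
    fun u w => bool_solve _ _ _ (h u w)
  have h0 : ∀ u : Fin 6 → Bool,
      c₂ (Fin.append u (fun j => a j u)) = (c₁ (emb r u) ^^ decide (∀ i, u i = false)) := by
    intro u
    have h' := hx u (fun _ => false)
    rw [hP0 u] at h'
    exact h'
  -- (ii) every `ĉ_k` is cubic
  have hk : ∀ k, IsDegLeFun 3 (fun u => decide (tcoef a (coefC c₂) k (id u) = 1)) := by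
    intro k
    have e : (fun u => decide (tcoef a (coefC c₂) k (id u) = 1)) =
        fun u => (c₁ (emb r u) ^^ c₁ (Fin.append u (yk k u))) := by
      funext u
      rw [id, tcoef_eq, zmod2_decide_add, ← expand c₂ h₂, ← expand c₂ h₂, decide_ind_eq_one,
        decide_ind_eq_one, ← hPyk k u, hx u (yk k u), h0 u]
      exact bool_cancel _ _ _
    rw [e]
    exact fc_deg_bxor (fc_isDegLeFun_comp h₁ (emb r) (emb_coord_deg r) (by norm_num))
      (fc_isDegLeFun_comp h₁ (fun u => Fin.append u (yk k u)) (append_coord_deg (yk k) (hyk k))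
        (by norm_num))
  -- so `ĉ` has even weight ...
  have hcore := core3 (γ := id) Function.bijective_id ha ha (coefC_deg c₂ h₂) hk
  have hsum1 : ∑ u, ind (c₂ (Fin.append u (fun j => a j u))) = 0 := by
    simp_rw [expand c₂ h₂]
    exact hcore
  -- ... but (i) `ĉ = c₁(·,0) ⊕ 1_{u = 0}` has odd weight
  have hc₁ : ∑ u, ind (c₁ (emb r u)) = 0 :=
    sum_ind_eq_zero_of_deg_five (fc_isDegLeFun_comp h₁ (emb r) (emb_coord_deg r) (by norm_num))
  have hδ : ∑ u : Fin 6 → Bool, ind (decide (∀ i, u i = false)) = 1 := by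
    rw [Finset.sum_eq_single (fun _ => false)]
    · simp
    · intro u _ hu
      have hu' : ¬ ∀ i, u i = false := fun h' => hu (funext h')
      simp [hu']
    · intro h'
      exact absurd (mem_univ _) h'
  have hsum2 : ∑ u, ind (c₂ (Fin.append u (fun j => a j u))) = 1 := by
    simp_rw [h0, ind_xor]
    rw [sum_add_distrib, hc₁, hδ, zero_add]
  exact zero_ne_one (hsum1.symm.trans hsum2)

end Summit.QuantumAdvantage.QuantumAdvantage.Theorems.NearExactIsExact.Negative.CylinderSix
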